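import Summits.AtomisticToContinuum.Crystallization.Theorems.ThreeConeCertificateSlackRigidityPricedFloorsTransport2
import Summits.AtomisticToContinuum.Crystallization.Theorems.ThreeConeCertificateSlackRigidityPricedFloorsGlobalize3
import Summits.AtomisticToContinuum.Crystallization.Theorems.PhononSlackCertificatesPeriodicGivenLayeredExtraction2
import HarnessLib

/-!
# `SlackRigidity` (stmt-AtomisticToContinuum-11960), line `priced-floors-palm-exactification`, stub S3
# (`stub_layeredMeanSelection`), package (U) "uniqueness of the layer system", part 1: plane sections

Lead c19, worker W12.  For normal-form layering data `e = (T, a, s, z)` fitting a set `S`, the layers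
are the PLANE SECTIONS of `S` orthogonal to the unit normal `n = T e₃`:
`layerOf e m = {p ∈ S | ⟪n, p⟫ = z m}` (`mem_layerOf_iff_inner`), because `u, v, w ⊥ e₃`, `T`
preserves inner products and the heights are injective.  Consequences proved here:

* `normal_eq_or_eq_neg` — if the two in-plane generators `T' u'`, `T' v'` of other normal data `e'`
  are orthogonal to `n`, then `n' = ± n` (coordinates in the orthonormal frame of `e'`);
* `heights_eq` — two strictly increasing `ℤ`-indexed enumerations of the same set of reals, both
  vanishing at `0`, coincide;
* `lms_layers_of_normal` (registered helper) — two data fitting the same set with the same normal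
  have the same layers; with opposite normals the layers correspond under `m ↦ −m`;
* `hexagon_step` — the key pattern lemma `globalize_pattern_hexagon` transported to every site: if
  `S` is invariant under the six translations of a regular planar hexagon of side `≤ 28/25` with a
  vertex off the layer plane of `e`, then at every layer the word of `e` does not switch and both
  spacings are the ideal `a √(2/3)` (used in part 2 for the fcc alternative).

All `[folklore]`.
-/

noncomputable section

open Set
open scoped BigOperators

namespace Summit.AtomisticToContinuum.Crystallization.Theorems.SlackRigidityPricedFloorsUnique

open Literature.MathematicalPhysics.StatisticalMechanics
open Summit.AtomisticToContinuum.Crystallization.Theorems.SlackRigidityPricedFloors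
open Summit.AtomisticToContinuum.Crystallization.Theorems.SlackRigidityPricedFloorsTransport
open Summit.AtomisticToContinuum.Crystallization.Theorems.SlackRigidityPricedFloorsGlobalize
open Summit.AtomisticToContinuum.Crystallization.Theorems.LayeredHull

/-- The frame of normal data preserves inner products. [folklore] -/
theorem inner_frame {e : LData} (he : IsNormalData e) (x y : E3) :
    inner ℝ (e.1 x) (e.1 y) = inner ℝ x y :=
  (frameIsometry e.1 he.1).inner_map_map x y

/-- `e₃` is orthogonal to a coded lateral vector plus `t e₃` exactly up to `t`. [folklore] -/
theorem inner_e3_coded (a : ℝ) (c : ℤ × ℤ) (t : ℝ) : inner ℝ e3 (lat a c + t • e3) = t := by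
  rw [Literature.Geometry.DiscreteGeometry.inner_fin3, lat_add_smul_apply_zero,
    lat_add_smul_apply_one, lat_add_smul_apply_two]
  simp [e3]

/-- **The normal coordinate of a pattern point is its height.** [folklore] -/
theorem inner_normal_pointOf {e : LData} (he : IsNormalData e) (m i j : ℤ) :
    inner ℝ (e.1 (layerNormal 1)) (pointOf e m i j) = e.2.2.2 m := by
  rw [pointOf, inner_frame he, combo_eq, layerNormal_one, inner_e3_coded]

/-- **Layers are plane sections**: for data fitting `S`, layer `m` is the set of points of `S` whose
normal coordinate is the height `z m`. [folklore] -/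
theorem mem_layerOf_iff_inner {S : Set E3} {e : LData} (he : Fits S e) (m : ℤ) (p : E3) :
    p ∈ layerOf e m ↔ p ∈ S ∧ inner ℝ (e.1 (layerNormal 1)) p = e.2.2.2 m := by
  constructor
  · rintro ⟨i, j, rfl⟩
    refine ⟨?_, inner_normal_pointOf he.1 m i j⟩
    rw [← he.2]
    exact ⟨m, i, j, rfl⟩
  · rintro ⟨hp, hin⟩
    rw [← he.2] at hp
    obtain ⟨m', i, j, rfl⟩ := (mem_dataSet_iff e p).1 hp
    rw [inner_normal_pointOf he.1] at hin
    obtain rfl := height_injective he.1 hin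
    exact pointOf_mem_layerOf e m' i j

/-! ## Two normals -/

/-- **If the in-plane generators of `e'` are orthogonal to the normal of `e`, the normals agree up to
sign.** [folklore] -/
theorem normal_eq_or_eq_neg {e e' : LData} (he : IsNormalData e) (he' : IsNormalData e')
    (h₁ : inner ℝ (e.1 (layerNormal 1)) (e'.1 (triangularVec₁ e'.2.1)) = 0)
    (h₂ : inner ℝ (e.1 (layerNormal 1)) (e'.1 (triangularVec₂ e'.2.1)) = 0) :
    e'.1 (layerNormal 1) = e.1 (layerNormal 1) ∨ e'.1 (layerNormal 1) = -e.1 (layerNormal 1) := by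
  set A : E3 ≃ₗᵢ[ℝ] E3 := (frameIsometry e'.1 he'.1).toLinearIsometryEquiv rfl with hAdef
  have hA : ∀ x, A x = e'.1 x := fun x => rfl
  set ν : E3 := A.symm (e.1 (layerNormal 1)) with hν
  have hn : e.1 (layerNormal 1) = A ν := (A.apply_symm_apply _).symm
  have hν1 : ‖ν‖ = 1 := by rw [hν, A.symm.norm_map, he.1, ext_norm_layerNormal_one]
  have i1 : inner ℝ ν (triangularVec₁ e'.2.1) = 0 := by
    rw [← A.inner_map_map, ← hn, hA]; exact h₁
  have i2 : inner ℝ ν (triangularVec₂ e'.2.1) = 0 := by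
    rw [← A.inner_map_map, ← hn, hA]; exact h₂
  have ha : e'.2.1 ≠ 0 := (spacing_pos he').ne'
  rw [Literature.Geometry.DiscreteGeometry.inner_fin3] at i1 i2
  simp only [triangularVec₁, triangularVec₂] at i1 i2
  simp at i1 i2
  have hν0 : ν 0 = 0 := by
    rcases i1 with h | h
    · exact h
    · exact absurd h ha
  have h3 : (√3 : ℝ) ≠ 0 := by positivity
  have hν1' : ν 1 = 0 := by
    rw [hν0] at i2
    have : ν 1 * (e'.2.1 * √3 / 2) = 0 := by linarith
    rcases mul_eq_zero.1 this with h | h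
    · exact h
    · exfalso; apply ha; nlinarith [h, h3, Real.sqrt_nonneg 3,
        mul_pos (show (0:ℝ) < 2 by norm_num) (Real.sqrt_pos.2 (show (0:ℝ) < 3 by norm_num))]
  have hsq : ν 2 ^ 2 = 1 := by
    have := Literature.Geometry.DiscreteGeometry.norm_sq_fin3 ν
    rw [hν1, hν0, hν1'] at this
    linarith
  have hν2 : ν 2 = 1 ∨ ν 2 = -1 := by
    have : (ν 2 - 1) * (ν 2 + 1) = 0 := by nlinarith [hsq]
    rcases mul_eq_zero.1 this with h | h
    · left; linarith
    · right; linarith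
  rcases hν2 with h | h
  · left
    rw [hn, ← hA]
    congr 1
    ext k
    fin_cases k <;> simp [layerNormal, hν0, hν1', h]
  · right
    rw [hn, ← map_neg, ← hA]
    congr 1
    ext k
    fin_cases k <;> simp [layerNormal, hν0, hν1', h]

/-! ## Heights -/

/-- The heights of normal data are strictly increasing. [folklore] -/
theorem strictMono_height {e : LData} (he : IsNormalData e) : StrictMono e.2.2.2 := by
  refine strictMono_int_of_lt_succ fun m => ?_
  have h1 := (he.2.1.2.2.2 m).1
  have ha := spacing_pos he
  linarith

/-- **Two strictly increasing enumerations of the same set of reals, both `0` at `0`, coincide.**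
[folklore] -/
theorem heights_eq {z z' : ℤ → ℝ} (hz : StrictMono z) (hz' : StrictMono z') (h0 : z 0 = 0)
    (h0' : z' 0 = 0) (h1 : ∀ m, ∃ k, z' m = z k) (h2 : ∀ m, ∃ k, z m = z' k) :
    ∀ m, z' m = z m := by
  intro m
  induction m using Int.induction_on with
  | zero => rw [h0, h0']
  | succ n ih =>
    apply le_antisymm
    · obtain ⟨k, hk⟩ := h2 (n + 1)
      have hlt : z' n < z' k := by rw [ih, ← hk]; exact hz (by omega)
      have hk' : (n : ℤ) + 1 ≤ k := Int.add_one_le_iff.2 (hz'.lt_iff_lt.1 hlt)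
      rw [hk]; exact hz'.monotone hk'
    · obtain ⟨k, hk⟩ := h1 (n + 1)
      have hlt : z n < z k := by rw [← ih, ← hk]; exact hz' (by omega)
      have hk' : (n : ℤ) + 1 ≤ k := Int.add_one_le_iff.2 (hz.lt_iff_lt.1 hlt)
      rw [hk]; exact hz.monotone hk'
  | pred n ih =>
    apply le_antisymm
    · obtain ⟨k, hk⟩ := h1 (-n - 1)
      have hlt : z k < z (-n) := by rw [← ih, ← hk]; exact hz' (by omega)
      have hk' : k ≤ -(n : ℤ) - 1 := by have := hz.lt_iff_lt.1 hlt; omega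
      rw [hk]; exact hz.monotone hk'
    · obtain ⟨k, hk⟩ := h2 (-n - 1)
      have hlt : z' k < z' (-n) := by rw [ih, ← hk]; exact hz (by omega)
      have hk' : k ≤ -(n : ℤ) - 1 := by have := hz'.lt_iff_lt.1 hlt; omega
      rw [hk]; exact hz'.monotone hk'

/-! ## Same normal, opposite normals -/

/-- **Same normal ⇒ same heights.** [folklore] -/
theorem heights_eq_of_normal_eq {S : Set E3} {e e' : LData} (he : Fits S e) (he' : Fits S e')
    (hn : e'.1 (layerNormal 1) = e.1 (layerNormal 1)) (m : ℤ) : e'.2.2.2 m = e.2.2.2 m := by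
  refine heights_eq (strictMono_height he.1) (strictMono_height he'.1) he.1.2.2 he'.1.2.2
    ?_ ?_ m
  · intro m
    have hp : pointOf e' m 0 0 ∈ dataSet e := by rw [he.2, ← he'.2]; exact ⟨m, 0, 0, rfl⟩
    obtain ⟨k, i, j, hk⟩ := (mem_dataSet_iff e _).1 hp
    refine ⟨k, ?_⟩
    rw [← inner_normal_pointOf he'.1 m 0 0, hk, hn, inner_normal_pointOf he.1]
  · intro m
    have hp : pointOf e m 0 0 ∈ dataSet e' := by rw [he'.2, ← he.2]; exact ⟨m, 0, 0, rfl⟩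
    obtain ⟨k, i, j, hk⟩ := (mem_dataSet_iff e' _).1 hp
    refine ⟨k, ?_⟩
    rw [← inner_normal_pointOf he.1 m 0 0, hk, ← hn, inner_normal_pointOf he'.1]

/-- **Same normal ⇒ same layers.** [folklore] -/
theorem layerOf_eq_of_normal_eq {S : Set E3} {e e' : LData} (he : Fits S e) (he' : Fits S e')
    (hn : e'.1 (layerNormal 1) = e.1 (layerNormal 1)) (m : ℤ) : layerOf e' m = layerOf e m := by
  ext p
  rw [mem_layerOf_iff_inner he, mem_layerOf_iff_inner he', hn, heights_eq_of_normal_eq he he' hn]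

/-- **Opposite normals ⇒ reversed heights.** [folklore] -/
theorem heights_eq_of_normal_eq_neg {S : Set E3} {e e' : LData} (he : Fits S e) (he' : Fits S e')
    (hn : e'.1 (layerNormal 1) = -e.1 (layerNormal 1)) (m : ℤ) :
    e'.2.2.2 m = -e.2.2.2 (-m) := by
  have hmono : StrictMono (fun m => -e.2.2.2 (-m)) := fun p q hpq => by
    simp only
    exact neg_lt_neg (strictMono_height he.1 (by omega))
  refine heights_eq (z := fun m => -e.2.2.2 (-m)) hmono (strictMono_height he'.1)
    (by simp [he.1.2.2]) he'.1.2.2 ?_ ?_ m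
  · intro m
    have hp : pointOf e' m 0 0 ∈ dataSet e := by rw [he.2, ← he'.2]; exact ⟨m, 0, 0, rfl⟩
    obtain ⟨k, i, j, hk⟩ := (mem_dataSet_iff e _).1 hp
    refine ⟨-k, ?_⟩
    simp only [neg_neg]
    rw [← inner_normal_pointOf he'.1 m 0 0, hk, hn, inner_neg_left, inner_normal_pointOf he.1]
  · intro m
    have hp : pointOf e (-m) 0 0 ∈ dataSet e' := by rw [he'.2, ← he.2]; exact ⟨-m, 0, 0, rfl⟩
    obtain ⟨k, i, j, hk⟩ := (mem_dataSet_iff e' _).1 hp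
    refine ⟨k, ?_⟩
    show -e.2.2.2 (-m) = e'.2.2.2 k
    rw [← inner_normal_pointOf he.1 (-m) 0 0, hk, ← inner_normal_pointOf he'.1 k i j, hn,
      inner_neg_left]

/-- **Opposite normals ⇒ layers correspond under `m ↦ −m`.** [folklore] -/
theorem layerOf_eq_of_normal_eq_neg {S : Set E3} {e e' : LData} (he : Fits S e) (he' : Fits S e')
    (hn : e'.1 (layerNormal 1) = -e.1 (layerNormal 1)) (m : ℤ) :
    layerOf e' m = layerOf e (-m) := by
  ext p
  rw [mem_layerOf_iff_inner he, mem_layerOf_iff_inner he', hn, heights_eq_of_normal_eq_neg he he' hn,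
    inner_neg_left, neg_inj]

/-- **Registered helper `lms_layers_of_normal`**: two normal-form data fitting the same set with the
same normal have the same layers; with opposite normals the layers correspond under `m ↦ −m`.
[folklore] -/
theorem lms_layers_of_normal : ∀ (S : Set E3) (e e' : LData), Fits S e → Fits S e' → (e'.1 (layerNormal 1) = e.1 (layerNormal 1) → ∀ m : ℤ, layerOf e' m = layerOf e m) ∧ (e'.1 (layerNormal 1) = -e.1 (layerNormal 1) → ∀ m : ℤ, layerOf e' m = layerOf e (-m)) :=
  fun _ _ _ he he' => ⟨fun hn m => layerOf_eq_of_normal_eq he he' hn m,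
    fun hn m => layerOf_eq_of_normal_eq_neg he he' hn m⟩

/-! ## Hexagons of sites -/

/-- Norms of the hexagon vectors `u`, `v`, `u − v` of spacing `a ≥ 0`. [folklore] -/
theorem norm_hexagon {a : ℝ} (ha : 0 ≤ a) :
    ‖triangularVec₁ a‖ = a ∧ ‖triangularVec₂ a‖ = a ∧ ‖triangularVec₁ a - triangularVec₂ a‖ = a := by
  have q1 : ‖triangularVec₁ a‖ ^ 2 = a ^ 2 := by
    rw [triangularVec₁_eq, norm_lat_sq]; simp [Qf]
  have q2 : ‖triangularVec₂ a‖ ^ 2 = a ^ 2 := by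
    rw [triangularVec₂_eq, norm_lat_sq]; simp [Qf]
  have q3 : ‖triangularVec₁ a - triangularVec₂ a‖ ^ 2 = a ^ 2 := by
    rw [triangularVec₁_eq, triangularVec₂_eq, ← lat_sub, norm_lat_sq]; simp [Qf]
  exact ⟨(sq_eq_sq₀ (norm_nonneg _) ha).1 q1, (sq_eq_sq₀ (norm_nonneg _) ha).1 q2,
    (sq_eq_sq₀ (norm_nonneg _) ha).1 q3⟩

/-- In-plane translations of pattern points: shifting the in-plane indices by `(p, q)` adds
`p T u + q T v`. [folklore] -/
theorem pointOf_add (e : LData) (m i j p q : ℤ) :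
    pointOf e m (i + p) (j + q) =
      pointOf e m i j + ((p : ℝ) • e.1 (triangularVec₁ e.2.1) + (q : ℝ) • e.1 (triangularVec₂ e.2.1)) := by
  simp only [pointOf]
  rw [← map_smul, ← map_smul, ← map_add, ← map_add]
  congr 1
  push_cast
  module

/-- A fitted set is invariant under the in-plane lattice translations of its data. [folklore] -/
theorem add_mem_of_fits {S : Set E3} {e : LData} (he : Fits S e) {y : E3} (hy : y ∈ S) (p q : ℤ) :
    y + ((p : ℝ) • e.1 (triangularVec₁ e.2.1) + (q : ℝ) • e.1 (triangularVec₂ e.2.1)) ∈ S := by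
  rw [← he.2] at hy ⊢
  obtain ⟨m, i, j, rfl⟩ := (mem_dataSet_iff e y).1 hy
  rw [← pointOf_add]
  exact ⟨m, i + p, j + q, rfl⟩

/-- The in-plane generators are the pattern points `(0,1,0)` and `(0,0,1)` of normal data. [folklore] -/
theorem pointOf_generators {e : LData} (he : IsNormalData e) :
    pointOf e 0 1 0 = e.1 (triangularVec₁ e.2.1) ∧ pointOf e 0 0 1 = e.1 (triangularVec₂ e.2.1) := by
  constructor <;> simp [pointOf, he.2.2]

/-- The in-plane generators of normal data are orthogonal to their own normal. [folklore] -/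
theorem inner_normal_generators {e : LData} (he : IsNormalData e) :
    inner ℝ (e.1 (layerNormal 1)) (e.1 (triangularVec₁ e.2.1)) = 0 ∧
      inner ℝ (e.1 (layerNormal 1)) (e.1 (triangularVec₂ e.2.1)) = 0 := by
  rw [inner_frame he, inner_frame he, triangularVec₁_eq, triangularVec₂_eq, layerNormal_one]
  exact ⟨inner_e3_lat _ _, inner_e3_lat _ _⟩

/-- **One hexagon step**: if `S` (fitted by `e`) is invariant under the six translations of a regular
planar hexagon `{±η, ±ξ, ±(η − ξ)}` of side `≤ 28/25` with `η` off the layer plane of `e`, then at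
every layer `m` the word does not switch, the two spacings around layer `m` are equal to the ideal
`√(2/3)·a`, and the side is `a`. [folklore] -/
theorem hexagon_step {S : Set E3} {e : LData} (he : Fits S e) {η ξ : E3} (hn1 : ‖ξ‖ = ‖η‖)
    (hn2 : ‖η - ξ‖ = ‖η‖) (hpos : 0 < ‖η‖) (hle : ‖η‖ ≤ 28 / 25)
    (hS : ∀ y ∈ S, y + ξ ∈ S ∧ y - ξ ∈ S ∧ y + (ξ - η) ∈ S ∧ y + (η - ξ) ∈ S ∧ y - η ∈ S)
    (hinner : inner ℝ (e.1 (layerNormal 1)) η ≠ 0) (m : ℤ) :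
    e.2.2.1 (m - 1) = e.2.2.1 m ∧ e.2.2.2 (m - 1) - e.2.2.2 m = -(e.2.2.2 (m + 1) - e.2.2.2 m) ∧
      (e.2.2.2 (m + 1) - e.2.2.2 m) ^ 2 = 2 * e.2.1 ^ 2 / 3 ∧ ‖η‖ = e.2.1 := by
  obtain ⟨hne, hSe⟩ := he
  have hfit := lms_rerootData_fits S e m 0 0 ⟨hne, hSe⟩
  set x := pointOf e m 0 0 with hx
  have hxS : x ∈ S := hSe ▸ ⟨m, 0, 0, rfl⟩
  have hmem : ∀ y ∈ S, y - x ∈ layeredSet (frameIsometry e.1 hne.1) e.2.1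
      (fun k => e.2.2.1 (k + m)) (fun k => e.2.2.2 (k + m) - e.2.2.2 m) := by
    intro y hy
    have h1 : y - x ∈ (fun y => y - pointOf e m 0 0) '' S := ⟨y, hy, rfl⟩
    rw [← hfit.2] at h1
    exact h1
  have hadm : IsAdmissibleLayering e.2.1 (fun k => e.2.2.1 (k + m))
      (fun k => e.2.2.2 (k + m) - e.2.2.2 m) := (isNormalData_rerootData hne m).2.1
  have hz0 : (fun k => e.2.2.2 (k + m) - e.2.2.2 m) 0 = 0 := by simp
  obtain ⟨h1, h2, h3, h4, h5⟩ := hS x hxS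
  have k1 := hmem _ h1
  have k2 := hmem _ h2
  have k3 := hmem _ h3
  have k4 := hmem _ h4
  have k5 := hmem _ h5
  rw [add_sub_cancel_left] at k1 k3 k4
  rw [sub_sub_cancel_left] at k2 k5
  have key := (globalize_pattern_hexagon (frameIsometry e.1 hne.1) e.2.1 _ _ hadm hz0 η ξ hn1 hn2
    hpos hle k1 k2 k3 k4 k5).2 hinner
  obtain ⟨ks, kz, kq, ka⟩ := key
  rw [zero_add] at ks
  rw [show (-1 : ℤ) + m = m - 1 by ring] at ks kz
  rw [show (1 : ℤ) + m = m + 1 by ring] at kz kq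
  exact ⟨ks, kz, kq, ka⟩

end Summit.AtomisticToContinuum.Crystallization.Theorems.SlackRigidityPricedFloorsUnique

end
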